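import Summits.KontsevichZagierPeriods.KontsevichZagierPeriods.Theorems.LinRedNormalFormHoffmanSpanInKZDerivedFast

/-!
# Crux `LinRedNormalForm.HoffmanSpanInKZ` (stmt-KontsevichZagierPeriods-15044), line `Sketch`:
# compact integer-scaled transcript rows (registered stub `stub_tablesZ`)

The elimination-transcript tables of `LinRedNormalFormHoffmanSpanInKZDerived` (`DRow` / `WRow`, checked by
the sparse checkers `dtableOk'` / `wtableOk'` of `LinRedNormalFormHoffmanSpanInKZDerivedFast`) carry one
rational per entry and spell every word as an index list.  From weight `11` on the tables have `≈ 2·10⁴`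
entries, so this file adds a COMPACT SPELLING, converted to `DRow` / `WRow` by pure functions before the
checkers run (no new soundness argument is needed: the checked table is the converted one):

* words are written as natural numbers — the binary word `ε₀ ε₁ ⋯ ε_{N-1}` (letter `0 = false`,
  `1 = true`) is the number `Σ εᵢ 2^{N-1-i}` (`wordOfCode`, `idxOfCode`);
* a derived row `DRowZ` carries its claimed vector over ONE common denominator (the citation
  coefficients keep their own denominators), a word row `WRowZ` carries all its coefficients over one
  common denominator;
* `dtabOf` / `wtabOf` convert whole tables; `TablesZSound` restates the soundness of the two-table format
  for converted tables (an instance of `edsCertificate_of_dwtables'`).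

Sources: the reflection set-up of `MzvKernelInKZTwoPosetsEdsCertificateLow`,
`LinRedNormalFormHoffmanSpanInKZDerived`, `LinRedNormalFormHoffmanSpanInKZDerivedFast` (this tree). [folklore]
-/

namespace Summit.KontsevichZagierPeriods.LinRedNormalForm.HoffmanSpanInKZ

open Literature.NumberTheory.Transcendental
open Summit.KontsevichZagierPeriods.MzvKernelInKZ.Negative
open Summit.KontsevichZagierPeriods.MzvKernelInKZ.TwoPosets

/-! ## Words as natural numbers -/

/-- The letters of the word with code `c` in length `N`: letter `i` is bit `N-1-i` of `c`. [folklore] -/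
def wordOfCode (N c : ℕ) : List Bool := (List.range N).reverse.map fun i => c.testBit i

/-- The index `(s₁, …, s_k)` of a word-as-list ending in `true` (lengths of the maximal blocks `0⋯01`);
a trailing block without `true` is dropped (never the case for admissible words). [folklore] -/
def idxOfWord : List Bool → List ℕ :=
  go 1
where
  /-- accumulate the current block length -/
  go : ℕ → List Bool → List ℕ
  | _, [] => []
  | n, false :: l => go (n + 1) l
  | n, true :: l => n :: go 1 l

/-- The index of the word with code `c` in length `N`. [folklore] -/
def idxOfCode (N c : ℕ) : List ℕ := idxOfWord (wordOfCode N c)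

/-! ## Compact rows -/

/-- A compact derived row: generator `g`, citations `L` of earlier derived rows `(index, numerator,
denominator)`, and the claimed vector as `(word code, numerator)` over the common denominator `dV`.
[folklore] -/
structure DRowZ where
  /-- the generator entering this row -/
  g : Gen
  /-- earlier derived rows, by index, with coefficients `num / den` -/
  L : List (ℕ × ℤ × ℕ)
  /-- common denominator of the claimed vector -/
  dV : ℕ
  /-- the claimed vector: word codes with numerators -/
  V : List (ℕ × ℤ)

/-- Conversion of a compact derived row to a `DRow` (length `N` for decoding word codes). [folklore] -/
def DRowZ.toDRow (N : ℕ) (d : DRowZ) : DRow :=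
  ⟨d.g, d.L, d.V.map fun p => (idxOfCode N p.1, p.2, d.dV)⟩

/-- A compact word row: the word (code), cited earlier words `P` (codes), Hoffman words `H` (codes) and
cited derived rows `E` (indices), all numerators over the common denominator `den`. [folklore] -/
structure WRowZ where
  /-- the word, as a code -/
  w : ℕ
  /-- common denominator of all coefficients of the row -/
  den : ℕ
  /-- cited words (codes), certified earlier, with numerators -/
  P : List (ℕ × ℤ)
  /-- Hoffman words (codes) with numerators -/
  H : List (ℕ × ℤ)
  /-- cited derived rows, by index, with numerators -/
  E : List (ℕ × ℤ)

/-- Conversion of a compact word row to a `WRow`. [folklore] -/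
def WRowZ.toWRow (N : ℕ) (c : WRowZ) : WRow :=
  ⟨idxOfCode N c.w, c.P.map fun p => (idxOfCode N p.1, p.2, c.den),
    c.H.map fun p => (idxOfCode N p.1, p.2, c.den), c.E.map fun p => (p.1, p.2, c.den)⟩

/-- Conversion of a compact derived table. [folklore] -/
def dtabOf (N : ℕ) (T : List DRowZ) : List DRow := T.map (DRowZ.toDRow N)

/-- Conversion of a compact word table. [folklore] -/
def wtabOf (N : ℕ) (T : List WRowZ) : List WRow := T.map (WRowZ.toWRow N)

/-! ## The registered stub -/

/-- Soundness of the two-table format for converted compact tables, as a statement about this file's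
conversions and the sparse checkers (not a published fact). -/
def TablesZSound : Prop :=
  ∀ (N : ℕ) (Δ : List DRowZ) (T : List WRowZ), dtableOk' N [] (dtabOf N Δ) = true →
    wtableOk' N ((dtabOf N Δ).map DRow.vfvec) [] (wtabOf N T) = true →
      (∀ ε : Fin N → Bool, Adm ε → ∃ c ∈ wtabOf N T, bword N c.w = ε) → EdsCertificate N

/-- **Registered stub `stub_tablesZ`** of the skeleton of line `Sketch` (compact spelling of the
weight-`11`/`12` transcript tables). -/
theorem stub_tablesZ : TablesZSound := fun N Δ T => edsCertificate_of_dwtables' N (dtabOf N Δ) (wtabOf N T)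

/-! ## Smoke test (kernel), weight `4`: the tables of the Derived file's smoke test, compactly -/

/-- Word codes at weight `4`: `ζ(4) = 0001 = 1`, `ζ(3,1) = 0011 = 3`, `ζ(2,2) = 0101 = 5`,
`ζ(2,1,1) = 0111 = 7`. -/
example : idxOfCode 4 1 = [4] ∧ idxOfCode 4 3 = [3, 1] ∧ idxOfCode 4 5 = [2, 2] ∧ idxOfCode 4 7 = [2, 1, 1] := by
  decide

example : dtableOk' 4 [] (dtabOf 4
    [⟨.F [2] [2], [], 1, [(3, 4), (1, -1)]⟩,
     ⟨.D [3], [(0, 1, 4)], 4, [(1, 3), (5, -4)]⟩,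
     ⟨.K [2, 1, 1], [], 1, [(7, 1), (1, -1)]⟩]) = true := by
  decide +kernel

example : wtableOk' 4 ((dtabOf 4
    [⟨.F [2] [2], [], 1, [(3, 4), (1, -1)]⟩,
     ⟨.D [3], [(0, 1, 4)], 4, [(1, 3), (5, -4)]⟩,
     ⟨.K [2, 1, 1], [], 1, [(7, 1), (1, -1)]⟩]).map DRow.vfvec) [] (wtabOf 4
    [⟨5, 1, [], [(5, 1)], []⟩,
     ⟨1, 3, [], [(5, 4)], [(1, 4)]⟩,
     ⟨3, 4, [(1, 1)], [], [(0, 1)]⟩,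
     ⟨7, 1, [(1, 1)], [], [(2, 1)]⟩]) = true := by
  decide +kernel

end Summit.KontsevichZagierPeriods.LinRedNormalForm.HoffmanSpanInKZ
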